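import Mathlib
import Summits.CriticalPhenomena.SAWScalingLimit.Theorems.SAWDefectDecoherenceDefectDecoherenceTmAdmissible
import Summits.CriticalPhenomena.SAWScalingLimit.Theorems.SAWDefectDecoherenceDefectDecoherenceTmStrataPrelim
import HarnessLib

/-!
# Telescoping over picture domains; orbit regrouping under `ℤ/3`
(helper `tm_orbit_bound` for the stub `stub_telescopingRecursion` of the line
`tip-martingale-depth-induction`, crux `DefectDecoherence`, stmt-CriticalPhenomena-8549)

* TELESCOPING: the walks of `Λ ∖ π` from `s(y,z)` to the star of `v` staying inside `B(v,s)` are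
  exactly the walks of the picture domain `picDom Λ v s (pic v s y z π)` (`TC_not_Ex_eq`), whence
  `T(Λ ∖ π) = T(pd_{s₀}) + Σ_{i<J} TC[pd_{s₀2^{i+1}}, exits s₀2^i] + TC[Λ ∖ π, exits s₀2^J]`
  (`defect_telescope`).
* ORBIT REGROUPING: for a picture functional `G` with `G(ρP) = conj(ζ²) G(P)` (`ρ = rotPic v`, of
  order `3`), `‖Σ_π w(π) G(pic π)‖ ≤ Σ_π contraction(pic π) · x_c^{|π|} ‖G(pic π)‖`
  (`orbit_bound`, registered as `tm_orbit_bound`): re-sum over pictures, average over the three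
  rotations, and use `‖Σ_k conj(ζ²)^k A(ρ^k P)‖ = contraction(P) · Σ_k m(ρ^k P)` together with the
  `ℤ/3`-invariance of the contraction (`contraction_rotPic`).

Sources: H. Duminil-Copin, S. Smirnov, *The connective constant of the honeycomb lattice equals
`√(2+√2)`*, Ann. of Math. 175 (2012) (arXiv:1007.0575), §1–§2 (walks between mid-edges, windings,
Definition 1); the line card `Lines/tip-martingale-depth-induction.md` of the crux.
Deliberately NOT here: the final assembly (file `…TelescopingRecursion`).
-/

noncomputable section

open scoped BigOperators ComplexConjugate Classical
open Literature.Probability.LatticeModels Literature.Probability.RandomPlanarGeometry.SAW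

namespace Summit.CriticalPhenomena.SAWScalingLimit.Theorems.DefectDecoherence.TipMartingale

section Telescoping

variable {v : HexVertex}

variable {Λ : Finset HexVertex} {u w y z : HexVertex} {R r : ℝ}

/-- The star of `v` in a picture domain of a deep configuration is the full star. [folklore] -/
theorem star_picDom (hA : Admissible Λ u w v R) (hr : 1 ≤ r) {s : ℝ} (hrs : r ≤ s)
    {π : HexMidEdgeSAW Λ s(u, w) s(y, z)} (hP : IsPrefix v r y z π) :
    star (picDom Λ v s (pic v s y z π)) v = star Λ v := by
  obtain ⟨-, -, -, -, -, hdeep⟩ := hA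
  have hout := ((isPrefix_iff π).1 hP).2.2.2
  ext t
  simp only [star, Finset.mem_filter, mem_picDom_pic]
  constructor
  · rintro ⟨⟨⟨ht, -⟩, -⟩, hadj⟩; exact ⟨ht, hadj⟩
  · rintro ⟨ht, hadj⟩
    have hd : dist (hexCenter t) (hexCenter v) ≤ 1 := by
      rw [dist_comm]; exact dist_hexCenter_le_one_of_adj hadj
    exact ⟨⟨⟨ht, hd.trans (hr.trans hrs)⟩, fun h => absurd (hout t h.1) (by linarith)⟩, hadj⟩

/-- **Staying inside `B(v,s)` = living in the picture domain**: for `pd_s ⊆ D₀ ⊆ Λ ∖ π`, the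
`TC` of `D₀` restricted to walks not leaving `B(v,s)` is the `TC` of `pd_s`. [folklore] -/
theorem TC_not_Ex_eq (hA : Admissible Λ u w v R) (hr : 1 ≤ r) {s : ℝ} (hrs : r ≤ s) (hsR : s ≤ R)
    {π : HexMidEdgeSAW Λ s(u, w) s(y, z)} (hP : IsPrefix v r y z π) {D₀ : Finset HexVertex}
    (h₁ : picDom Λ v s (pic v s y z π) ⊆ D₀) (h₂ : D₀ ⊆ Λ \ π.verts.toFinset)
    (E : List HexVertex → Prop) :
    TC D₀ s(y, z) v (fun l => E l ∧ l ∉ Ex v s) = TC (picDom Λ v s (pic v s y z π)) s(y, z) v E := by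
  obtain ⟨hyz, hz, hout⟩ := ((isPrefix_iff π).1 hP).2
  have hdeep := hA.2.2.2.2.2
  have hmem : ∀ q ∈ Λ \ π.verts.toFinset, q ∈ picDom Λ v s (pic v s y z π) ↔
      dist (hexCenter q) (hexCenter v) ≤ s := fun q hq => by
    rw [Finset.mem_sdiff, List.mem_toFinset] at hq
    rw [mem_picDom_pic]
    exact ⟨fun h => h.1.2, fun h => ⟨⟨hq.1, h⟩, fun h' => hq.2 h'.1⟩⟩
  rw [TC_congr (E' := fun l => E l ∧ ∀ q ∈ l, q ∈ picDom Λ v s (pic v s y z π)) fun l hl => ?_]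
  · refine TC_stay h₁ ?_ ⟨(SimpleGraph.mem_edgeSet _).2 hyz, z, Sym2.mem_mk_right _ _, ?_⟩ E
    · rw [star_picDom hA hr hrs hP]
      refine Finset.Subset.antisymm ?_ (Finset.filter_subset_filter _ (h₂.trans Finset.sdiff_subset))
      rw [← star_picDom hA hr hrs hP]
      exact Finset.filter_subset_filter _ h₁
    · rw [mem_picDom_pic]
      exact ⟨⟨hdeep z (hz.trans (hrs.trans hsR)), hz.trans hrs⟩, fun h => absurd (hout z h.1)
        (not_lt.2 hz)⟩
  · simp only [mem_Ex, not_exists, not_and, not_lt]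
    exact and_congr_right fun _ => forall₂_congr fun q hq => (hmem q (h₂ (hl q hq))).symm

/-- **THE TELESCOPING IDENTITY** (step (3) of the line): across the scales `s₀ 2^i ≤ R`,
`T(Λ ∖ π) = T(pd_{s₀}) + Σ_{i<J} TC[pd_{s₀2^{i+1}}, exits s₀2^i] + TC[Λ ∖ π, exits s₀2^J]`.
[folklore] -/
theorem defect_telescope (hA : Admissible Λ u w v R) (hr : 1 ≤ r)
    {π : HexMidEdgeSAW Λ s(u, w) s(y, z)} (hP : IsPrefix v r y z π) {s₀ : ℝ} (hs₀ : r ≤ s₀) :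
    ∀ J : ℕ, s₀ * 2 ^ J ≤ R →
    defect (Λ \ π.verts.toFinset) y z v =
      defect (picDom Λ v s₀ (pic v s₀ y z π)) y z v +
      (∑ i ∈ Finset.range J, TC (picDom Λ v (s₀ * 2 ^ (i + 1)) (pic v (s₀ * 2 ^ (i + 1)) y z π))
        s(y, z) v (· ∈ Ex v (s₀ * 2 ^ i))) +
      TC (Λ \ π.verts.toFinset) s(y, z) v (· ∈ Ex v (s₀ * 2 ^ J))
  | 0, hJ => by
    rw [pow_zero, mul_one] at hJ ⊢
    rw [Finset.sum_range_zero, add_zero, defect_eq_TC, defect_eq_TC,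
      TC_split (fun _ => True) (· ∈ Ex v s₀), add_comm]
    congr 1
    · rw [← TC_not_Ex_eq hA hr hs₀ hJ hP (picDom_subset π) subset_rfl]
    · exact TC_congr fun l _ => by simp
  | J + 1, hJ => by
    have hJ' : s₀ * 2 ^ J ≤ R :=
      le_trans (mul_le_mul_of_nonneg_left (pow_le_pow_right₀ one_le_two J.le_succ)
        (le_trans (zero_le_one.trans hr) hs₀)) hJ
    have hsJ : r ≤ s₀ * 2 ^ (J + 1) :=
      hs₀.trans (le_mul_of_one_le_right (le_trans (zero_le_one.trans hr) hs₀)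
        (one_le_pow₀ one_le_two))
    have hmono : s₀ * 2 ^ J ≤ s₀ * 2 ^ (J + 1) :=
      mul_le_mul_of_nonneg_left (pow_le_pow_right₀ one_le_two J.le_succ)
        (le_trans (zero_le_one.trans hr) hs₀)
    have hsplit : TC (Λ \ π.verts.toFinset) s(y, z) v (· ∈ Ex v (s₀ * 2 ^ J)) =
        TC (picDom Λ v (s₀ * 2 ^ (J + 1)) (pic v (s₀ * 2 ^ (J + 1)) y z π)) s(y, z) v
          (· ∈ Ex v (s₀ * 2 ^ J)) +
        TC (Λ \ π.verts.toFinset) s(y, z) v (· ∈ Ex v (s₀ * 2 ^ (J + 1))) := by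
      rw [TC_split (· ∈ Ex v (s₀ * 2 ^ J)) (· ∈ Ex v (s₀ * 2 ^ (J + 1))), add_comm]
      congr 1
      · exact TC_not_Ex_eq hA hr hsJ hJ hP (picDom_subset π) subset_rfl _
      · refine TC_congr fun l _ => ⟨fun h => h.2, fun h => ⟨?_, h⟩⟩
        obtain ⟨q, hq, hlt⟩ := h
        exact ⟨q, hq, lt_of_le_of_lt hmono hlt⟩
    rw [defect_telescope hA hr hP hs₀ J hJ', Finset.sum_range_succ, hsplit]
    ring

end Telescoping

/-! ### Orbit regrouping under the `ℤ/3` action -/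

section Orbit

variable {Λ : Finset HexVertex} {u w : HexVertex} (v : HexVertex) (r s : ℝ)

/-- The `ℤ/3` action on pictures has order `3`. [folklore] -/
theorem rotPic_rotPic_rotPic (P : Picture) : rotPic v (rotPic v (rotPic v P)) = P := by
  obtain ⟨S, y, z⟩ := P
  simp only [rotPic]
  refine Prod.ext ?_ (Prod.ext (rot3_rot3_rot3 v y) (rot3_rot3_rot3 v z))
  show ((S.image (rot3 v)).image (rot3 v)).image (rot3 v) = S
  rw [Finset.image_image, Finset.image_image,
    show ((rot3 v ∘ rot3 v) ∘ rot3 v) = id from funext fun q => rot3_rot3_rot3 v q, Finset.image_id]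

/-- The first-entrance prefixes as a finite set of (dart, prefix) pairs. [folklore] -/
def prefixes (Λ : Finset HexVertex) (u w v : HexVertex) (r : ℝ) :
    Finset ((p : HexVertex × HexVertex) × HexMidEdgeSAW Λ s(u, w) s(p.1, p.2)) :=
  (Λ ×ˢ Λ).sigma fun p => Finset.univ.filter fun π => IsPrefix v r p.1 p.2 π

/-- `prefixSumC` as a sum over `prefixes`. [folklore] -/
theorem prefixSumC_eq (f : ∀ y z : HexVertex, HexMidEdgeSAW Λ s(u, w) s(y, z) → ℂ) :
    prefixSumC Λ u w v r f = ∑ σ ∈ prefixes Λ u w v r, f σ.1.1 σ.1.2 σ.2 := by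
  rw [prefixSumC, prefixes, Finset.sum_sigma]
  refine Finset.sum_congr rfl fun p _ => ?_
  rw [Finset.sum_filter]

/-- `prefixSumR` as a sum over `prefixes`. [folklore] -/
theorem prefixSumR_eq (f : ∀ y z : HexVertex, HexMidEdgeSAW Λ s(u, w) s(y, z) → ℝ) :
    prefixSumR Λ u w v r f = ∑ σ ∈ prefixes Λ u w v r, f σ.1.1 σ.1.2 σ.2 := by
  rw [prefixSumR, prefixes, Finset.sum_sigma]
  refine Finset.sum_congr rfl fun p _ => ?_
  rw [Finset.sum_filter]

/-- `conj(ζ²)³ = 1`. [folklore] -/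
theorem conj_zeta_sq_pow_three : ((starRingEnd ℂ) (triZeta ^ 2)) ^ 3 = 1 := by
  have h3 : triZeta ^ 3 = -1 := by linear_combination (triZeta + 1) * triZeta_sq
  rw [← map_pow, show (triZeta ^ 2) ^ 3 = (triZeta ^ 3) ^ 2 by ring, h3]
  simp

/-- `‖conj(ζ²)‖ = 1`. [folklore] -/
theorem norm_conj_zeta_sq : ‖(starRingEnd ℂ) (triZeta ^ 2)‖ = 1 := by
  rw [Complex.norm_conj, norm_triZeta_sq]

/-- The prefix mass of a picture is nonnegative. [folklore] -/
theorem picMass_nonneg (Q : Picture) : 0 ≤ picMass Λ u w v r s Q :=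
  Finset.sum_nonneg fun _ _ => Finset.sum_nonneg fun _ _ => by
    dsimp only
    split_ifs <;> first | exact le_rfl | exact pow_nonneg xc_pos.le _

/-- `‖A(Q)‖ ≤ m(Q)` termwise. [folklore] -/
theorem norm_picAmp_le (Q : Picture) : ‖picAmp Λ u w v r s Q‖ ≤ picMass Λ u w v r s Q := by
  unfold picAmp picMass prefixSumC prefixSumR
  refine (norm_sum_le _ _).trans (Finset.sum_le_sum fun p _ => (norm_sum_le _ _).trans
    (Finset.sum_le_sum fun π _ => ?_))
  by_cases hP : IsPrefix v r p.1 p.2 π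
  · rw [if_pos hP, if_pos hP]
    dsimp only
    by_cases hQ : pic v s p.1 p.2 π = Q
    · rw [if_pos hQ, if_pos hQ, π.norm_weight xc_pos.le]
    · rw [if_neg hQ, if_neg hQ, norm_zero]
  · rw [if_neg hP, if_neg hP, norm_zero]

/-- The three-term orbit sums, expanded. [folklore] -/
theorem sum_range_three {M : Type*} [AddCommMonoid M] (f : ℕ → M) :
    ∑ k ∈ Finset.range 3, f k = f 0 + f 1 + f 2 := by
  simp [Finset.sum_range_succ]

/-- **The orbit contraction is `ℤ/3`-invariant.** [folklore] -/
theorem contraction_rotPic (Q : Picture) :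
    contraction Λ u w v r s (rotPic v Q) = contraction Λ u w v r s Q := by
  have h3 := conj_zeta_sq_pow_three
  have hnum : picAmp Λ u w v r s (rotPic v Q) +
      (starRingEnd ℂ) (triZeta ^ 2) * picAmp Λ u w v r s (rotPic v (rotPic v Q)) +
      (starRingEnd ℂ) (triZeta ^ 2) ^ 2 * picAmp Λ u w v r s Q =
      (starRingEnd ℂ) (triZeta ^ 2) ^ 2 * (picAmp Λ u w v r s Q +
        (starRingEnd ℂ) (triZeta ^ 2) * picAmp Λ u w v r s (rotPic v Q) +
        (starRingEnd ℂ) (triZeta ^ 2) ^ 2 * picAmp Λ u w v r s (rotPic v (rotPic v Q))) := by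
    linear_combination (-(picAmp Λ u w v r s (rotPic v Q) +
      (starRingEnd ℂ) (triZeta ^ 2) * picAmp Λ u w v r s (rotPic v (rotPic v Q)))) * h3
  have hden : picMass Λ u w v r s (rotPic v Q) + picMass Λ u w v r s (rotPic v (rotPic v Q)) +
      picMass Λ u w v r s Q = picMass Λ u w v r s Q + picMass Λ u w v r s (rotPic v Q) +
        picMass Λ u w v r s (rotPic v (rotPic v Q)) := by ring
  unfold contraction
  rw [sum_range_three, sum_range_three, sum_range_three, sum_range_three]
  simp only [Function.iterate_zero_apply, Function.iterate_succ_apply', rotPic_rotPic_rotPic,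
    pow_zero, one_mul, pow_one]
  rw [hnum, hden, norm_mul, norm_pow, norm_conj_zeta_sq, one_pow, one_mul]

/-- **ORBIT REGROUPING** (step (5) of the line): for a `conj(ζ²)`-covariant picture functional
`G`, `‖Σ_π w(π) G(pic π)‖ ≤ Σ_π contraction(pic π) x_c^{|π|} ‖G(pic π)‖`. [folklore] -/
theorem orbit_bound (G : Picture → ℂ)
    (hG : ∀ P, G (rotPic v P) = (starRingEnd ℂ) (triZeta ^ 2) * G P) :
    ‖prefixSumC Λ u w v r (fun y z π => π.weight xc (5 / 8) * G (pic v s y z π))‖ ≤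
      prefixSumR Λ u w v r (fun y z π => contraction Λ u w v r s (pic v s y z π) *
        (xc ^ π.length * ‖G (pic v s y z π)‖)) := by
  have hρ3 : ∀ Q, rotPic v (rotPic v (rotPic v Q)) = Q := rotPic_rotPic_rotPic v
  have hob3 := conj_zeta_sq_pow_three
  -- an invariant finite set of pictures containing all pictures of prefixes
  obtain ⟨PP, hmaps, hρPP⟩ : ∃ PP : Finset Picture,
      (∀ σ ∈ prefixes Λ u w v r, pic v s σ.1.1 σ.1.2 σ.2 ∈ PP) ∧ ∀ Q ∈ PP, rotPic v Q ∈ PP := by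
    refine ⟨((prefixes Λ u w v r).image fun σ => pic v s σ.1.1 σ.1.2 σ.2) ∪
      ((prefixes Λ u w v r).image fun σ => rotPic v (pic v s σ.1.1 σ.1.2 σ.2)) ∪
      ((prefixes Λ u w v r).image fun σ => rotPic v (rotPic v (pic v s σ.1.1 σ.1.2 σ.2))),
      fun σ hσ => ?_, fun Q hQ => ?_⟩
    · exact Finset.mem_union_left _ (Finset.mem_union_left _ (Finset.mem_image_of_mem _ hσ))
    · simp only [Finset.mem_union, Finset.mem_image] at hQ ⊢
      rcases hQ with (⟨σ, hσ, rfl⟩ | ⟨σ, hσ, rfl⟩) | ⟨σ, hσ, rfl⟩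
      · exact Or.inl (Or.inr ⟨σ, hσ, rfl⟩)
      · exact Or.inr ⟨σ, hσ, rfl⟩
      · exact Or.inl (Or.inl ⟨σ, hσ, by rw [hρ3]⟩)
  have hsumρ : ∀ {M : Type} [AddCommMonoid M] (F : Picture → M),
      ∑ Q ∈ PP, F (rotPic v Q) = ∑ Q ∈ PP, F Q := fun F =>
    Finset.sum_nbij' (rotPic v) (fun Q => rotPic v (rotPic v Q)) hρPP
      (fun Q hQ => hρPP _ (hρPP _ hQ)) (fun Q _ => hρ3 Q) (fun Q _ => hρ3 Q) fun _ _ => rfl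
  -- fibre sums
  have hAfib : ∀ Q, picAmp Λ u w v r s Q =
      ∑ σ ∈ prefixes Λ u w v r with pic v s σ.1.1 σ.1.2 σ.2 = Q, σ.2.weight xc (5 / 8) :=
    fun Q => by rw [picAmp, prefixSumC_eq, Finset.sum_filter]
  have hmfib : ∀ Q, picMass Λ u w v r s Q =
      ∑ σ ∈ prefixes Λ u w v r with pic v s σ.1.1 σ.1.2 σ.2 = Q, xc ^ σ.2.length :=
    fun Q => by rw [picMass, prefixSumR_eq, Finset.sum_filter]
  -- Step 1: the picture sum
  have hX : prefixSumC Λ u w v r (fun y z π => π.weight xc (5 / 8) * G (pic v s y z π)) =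
      ∑ Q ∈ PP, picAmp Λ u w v r s Q * G Q := by
    rw [prefixSumC_eq, ← Finset.sum_fiberwise_of_maps_to hmaps]
    refine Finset.sum_congr rfl fun Q _ => ?_
    rw [hAfib, Finset.sum_mul]
    refine Finset.sum_congr rfl fun σ hσ => ?_
    rw [(Finset.mem_filter.1 hσ).2]
  -- Step 2: rotate twice and average
  have e1 : ∑ Q ∈ PP, picAmp Λ u w v r s Q * G Q =
      ∑ Q ∈ PP, (starRingEnd ℂ) (triZeta ^ 2) * picAmp Λ u w v r s (rotPic v Q) * G Q := by
    rw [← hsumρ fun Q => picAmp Λ u w v r s Q * G Q]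
    refine Finset.sum_congr rfl fun Q _ => ?_
    rw [hG]; ring
  have e2 : ∑ Q ∈ PP, picAmp Λ u w v r s Q * G Q =
      ∑ Q ∈ PP, (starRingEnd ℂ) (triZeta ^ 2) ^ 2 *
        picAmp Λ u w v r s (rotPic v (rotPic v Q)) * G Q := by
    rw [e1, ← hsumρ fun Q => (starRingEnd ℂ) (triZeta ^ 2) * picAmp Λ u w v r s (rotPic v Q) *
      G Q]
    refine Finset.sum_congr rfl fun Q _ => ?_
    rw [hG]; ring
  have hX3 : (3 : ℂ) * prefixSumC Λ u w v r (fun y z π => π.weight xc (5 / 8) *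
      G (pic v s y z π)) = ∑ Q ∈ PP, (∑ k ∈ Finset.range 3, (starRingEnd ℂ) (triZeta ^ 2) ^ k *
        picAmp Λ u w v r s ((rotPic v)^[k] Q)) * G Q := by
    rw [hX]
    calc (3 : ℂ) * ∑ Q ∈ PP, picAmp Λ u w v r s Q * G Q
        = (∑ Q ∈ PP, picAmp Λ u w v r s Q * G Q) +
          (∑ Q ∈ PP, (starRingEnd ℂ) (triZeta ^ 2) * picAmp Λ u w v r s (rotPic v Q) * G Q) +
          (∑ Q ∈ PP, (starRingEnd ℂ) (triZeta ^ 2) ^ 2 *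
            picAmp Λ u w v r s (rotPic v (rotPic v Q)) * G Q) := by rw [← e1, ← e2]; ring
      _ = _ := by
        rw [← Finset.sum_add_distrib, ← Finset.sum_add_distrib]
        refine Finset.sum_congr rfl fun Q _ => ?_
        simp only [sum_range_three, Function.iterate_zero_apply, Function.iterate_succ_apply',
          pow_zero, one_mul, pow_one]
        ring
  -- Step 3: numerators in terms of the contraction
  have hNQ : ∀ Q, ‖∑ k ∈ Finset.range 3, (starRingEnd ℂ) (triZeta ^ 2) ^ k *
      picAmp Λ u w v r s ((rotPic v)^[k] Q)‖ = contraction Λ u w v r s Q *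
        ∑ k ∈ Finset.range 3, picMass Λ u w v r s ((rotPic v)^[k] Q) := fun Q => by
    rw [contraction]
    by_cases hD : ∑ k ∈ Finset.range 3, picMass Λ u w v r s ((rotPic v)^[k] Q) = 0
    · have hmk := (Finset.sum_eq_zero_iff_of_nonneg fun k _ => picMass_nonneg v r s
        ((rotPic v)^[k] Q)).1 hD
      rw [hD, mul_zero, norm_eq_zero]
      refine Finset.sum_eq_zero fun k hk => mul_eq_zero_of_right _ ?_
      exact norm_le_zero_iff.1 ((norm_picAmp_le v r s _).trans (le_of_eq (hmk k hk)))
    · rw [div_mul_cancel₀ _ hD]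
  -- Step 4: the bound on pictures
  have hGn : ∀ Q, ‖G (rotPic v Q)‖ = ‖G Q‖ := fun Q => by
    rw [hG, norm_mul, norm_conj_zeta_sq, one_mul]
  have key : ‖prefixSumC Λ u w v r (fun y z π => π.weight xc (5 / 8) * G (pic v s y z π))‖ ≤
      ∑ Q ∈ PP, contraction Λ u w v r s Q * picMass Λ u w v r s Q * ‖G Q‖ := by
    have h3 : ‖prefixSumC Λ u w v r (fun y z π => π.weight xc (5 / 8) * G (pic v s y z π))‖ =
        ‖(3 : ℂ) * prefixSumC Λ u w v r (fun y z π => π.weight xc (5 / 8) *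
          G (pic v s y z π))‖ / 3 := by
      rw [norm_mul]; simp
    rw [h3, hX3, div_le_iff₀ (by norm_num : (0 : ℝ) < 3)]
    refine (norm_sum_le _ _).trans (le_of_eq ?_)
    calc ∑ Q ∈ PP, ‖(∑ k ∈ Finset.range 3, (starRingEnd ℂ) (triZeta ^ 2) ^ k *
          picAmp Λ u w v r s ((rotPic v)^[k] Q)) * G Q‖
        = ∑ Q ∈ PP, contraction Λ u w v r s Q *
            (∑ k ∈ Finset.range 3, picMass Λ u w v r s ((rotPic v)^[k] Q)) * ‖G Q‖ :=
          Finset.sum_congr rfl fun Q _ => by rw [norm_mul, hNQ]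
      _ = (∑ Q ∈ PP, contraction Λ u w v r s Q * picMass Λ u w v r s Q * ‖G Q‖) +
          (∑ Q ∈ PP, contraction Λ u w v r s Q * picMass Λ u w v r s (rotPic v Q) * ‖G Q‖) +
          (∑ Q ∈ PP, contraction Λ u w v r s Q *
            picMass Λ u w v r s (rotPic v (rotPic v Q)) * ‖G Q‖) := by
          rw [← Finset.sum_add_distrib, ← Finset.sum_add_distrib]
          refine Finset.sum_congr rfl fun Q _ => ?_
          simp only [sum_range_three, Function.iterate_zero_apply, Function.iterate_succ_apply']
          ring
      _ = (∑ Q ∈ PP, contraction Λ u w v r s Q * picMass Λ u w v r s Q * ‖G Q‖) * 3 := by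
          have r1 : ∑ Q ∈ PP, contraction Λ u w v r s Q * picMass Λ u w v r s (rotPic v Q) *
              ‖G Q‖ = ∑ Q ∈ PP, contraction Λ u w v r s Q * picMass Λ u w v r s Q * ‖G Q‖ := by
            rw [← hsumρ fun Q => contraction Λ u w v r s Q * picMass Λ u w v r s Q * ‖G Q‖]
            refine Finset.sum_congr rfl fun Q _ => ?_
            rw [contraction_rotPic, hGn]
          have r2 : ∑ Q ∈ PP, contraction Λ u w v r s Q *
              picMass Λ u w v r s (rotPic v (rotPic v Q)) * ‖G Q‖ =
              ∑ Q ∈ PP, contraction Λ u w v r s Q * picMass Λ u w v r s Q * ‖G Q‖ := by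
            rw [← r1, ← hsumρ fun Q => contraction Λ u w v r s Q *
              picMass Λ u w v r s (rotPic v Q) * ‖G Q‖]
            refine Finset.sum_congr rfl fun Q _ => ?_
            rw [contraction_rotPic, hGn]
          rw [r1, r2]; ring
  -- Step 5: back to prefixes
  refine key.trans (le_of_eq ?_)
  rw [prefixSumR_eq, ← Finset.sum_fiberwise_of_maps_to hmaps]
  refine Finset.sum_congr rfl fun Q _ => ?_
  rw [hmfib, Finset.mul_sum, Finset.sum_mul]
  refine Finset.sum_congr rfl fun σ hσ => ?_
  rw [(Finset.mem_filter.1 hσ).2]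
  ring

end Orbit

/-- **Registered helper `tm_orbit_bound`**. [folklore] -/
theorem tm_orbit_bound : ∀ (Λ : Finset HexVertex) (u w v : HexVertex) (r s : ℝ) (G : Picture → ℂ),
    (∀ P, G (rotPic v P) = (starRingEnd ℂ) (triZeta ^ 2) * G P) →
    ‖prefixSumC Λ u w v r (fun y z π => π.weight xc (5 / 8) * G (pic v s y z π))‖ ≤
      prefixSumR Λ u w v r (fun y z π => contraction Λ u w v r s (pic v s y z π) *
        (xc ^ π.length * ‖G (pic v s y z π)‖)) :=
  fun _ _ _ v r s G hG => orbit_bound v r s G hG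

end Summit.CriticalPhenomena.SAWScalingLimit.Theorems.DefectDecoherence.TipMartingale

end
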